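import Summits.KontsevichZagierPeriods.KontsevichZagierPeriods.Theorems.HurwitzMicroSectorsNormalFormPrincipleDilogBoxSubSimplex

/-!
# `NormalFormPrinciple` (stmt-KontsevichZagierPeriods-3869), line `SketchIdeator1` —
# leaf `stub_boxRigidity`, dilogarithm layer: the simplex pieces `A(z)`, `A'(w)`, `M(z)` exist

Pure proof file (stub `exists_simplexPieces_one` of the layer `Dilog`, lead seat c9; `--supports`
the crux). The dilogarithm functional equations are move chains of the Kontsevich–Zagier calculus
between box atoms on `(0,1)²` and *simplex pieces* of the `ζ(2)` simplex `{0 < t₁ < t₀ < 1}` with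
integrand `f(t) = 1/(t₀(1 − t₁))`. This file supplies the EXISTENCE, as honest integral
representations (`Literature.NumberTheory.Transcendental.KZ.IntegralRep 2`), of three pieces:
`A(z) = [{0 < t₁ < t₀ < z}, f]` for real algebraic `0 < z ≤ 1` (value `Li₂(z)`; `A(1)` is the
whole `ζ(2)` simplex, with integrand unbounded near `t₀ → 0` and `t₁ → 1`);
`A'(w) = [{w < t₀ < t₁ < 0}, f]` for real algebraic `w < 0` (value `Li₂(w)`); and the Möbius piece
`M(z) = [{0 < t₁ < t₀ < z}, −1/(t₀(1 − t₀)(1 − t₁))]` for real algebraic `0 < z < 1`.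

The domains are cut out by strict linear inequalities with real algebraic constants, hence are
`ℚ`-semialgebraic; the integrands are quotients of `ℚ`-polynomials with non-vanishing denominators
on the domains. Absolute convergence is reduced to the box atoms by the merge–scale chart
`Φ_s(x₀, x₁) = (s x₀, s x₀ x₁)` of the open unit box `□` (`bss_exists_mergeScaleChart`: Jacobian
`s² x₀`, injective on `□`, image `{0 < t₁ < t₀ < s}` for `s > 0` and `{s < t₀ < t₁ < 0}` for
`s < 0`): by Mathlib's `MeasureTheory.integrableOn_image_iff_integrableOn_abs_det_fderiv_smul`,
`g` is integrable on the piece as soon as `s² x₀ · g(Φ_s x)` is integrable on `□`, and the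
pulled-back integrands are the dilogarithm integrand `1/(1/s − x₀x₁)` (`bss_pullback`,
`integrableOn_dilogIntegrand`, as `1/s ≥ 1` or `1/s < 0`) and `−s/((1 − s x₀)(1 − s x₀x₁))`,
dominated by `(s/(1 − s))/(1 − x₀x₁)` on `□` (`integrableOn_box_of_abs_le`). No move of the
calculus is performed here.

References: M. Kontsevich, D. Zagier, *Periods* (2001), §1.1–1.2; F. Beukers, *A note on the
irrationality of ζ(2) and ζ(3)*, Bull. LMS 11 (1979). No definitions are introduced.
-/

noncomputable section

open MeasureTheory Set
open Literature.NumberTheory.Transcendental Literature.NumberTheory.Transcendental.KZ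
open Literature.ModelTheory.ExponentialFields (IsSemialgebraic)

namespace Summit.KontsevichZagierPeriods.HurwitzMicroSectors.NormalFormPrinciple.PiBox.Dilog

/-! ## Absolute convergence of the three pieces (pull-back to the box) -/

/-- **Integrability transfer along the merge–scale chart** (Mathlib's change of variables
`MeasureTheory.integrableOn_image_iff_integrableOn_abs_det_fderiv_smul`): if `Φ` is injective and
differentiable on the open unit box `□` with `|det DΦ(x)| = s² x₀` there, then `g` is integrable on
`Φ '' □` as soon as `s² x₀ · g(Φ x)` is integrable on `□`. [folklore] -/
theorem spA_integrableOn_image_chart {s : ℝ} {g : (Fin 2 → ℝ) → ℝ}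
    {Φ : (Fin 2 → ℝ) → (Fin 2 → ℝ)} {Φ' : (Fin 2 → ℝ) → (Fin 2 → ℝ) →L[ℝ] (Fin 2 → ℝ)}
    (hderiv : ∀ x, HasFDerivAt Φ (Φ' x) x)
    (hinj : Set.InjOn Φ {x : Fin 2 → ℝ | ∀ i, x i ∈ Set.Ioo (0:ℝ) 1})
    (hdet : ∀ x ∈ {x : Fin 2 → ℝ | ∀ i, x i ∈ Set.Ioo (0:ℝ) 1}, |(Φ' x).det| = s ^ 2 * x 0)
    (hg : IntegrableOn (fun x : Fin 2 → ℝ => s ^ 2 * x 0 * g (Φ x))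
      {x | ∀ i, x i ∈ Set.Ioo (0:ℝ) 1}) :
    IntegrableOn g (Φ '' {x : Fin 2 → ℝ | ∀ i, x i ∈ Set.Ioo (0:ℝ) 1}) := by
  have hS : MeasurableSet {x : Fin 2 → ℝ | ∀ i, x i ∈ Set.Ioo (0:ℝ) 1} :=
    (isSemialgebraic_box 2).measurableSet_holds
  rw [integrableOn_image_iff_integrableOn_abs_det_fderiv_smul volume hS
    (fun x _ => (hderiv x).hasFDerivWithinAt) hinj]
  refine hg.congr_fun (fun x hx => ?_) hS
  show s ^ 2 * x 0 * g (Φ x) = |(Φ' x).det| • g (Φ x)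
  rw [hdet x hx, smul_eq_mul]

/-- **Pull-back of `f = 1/(t₀(1 − t₁))` along the merge–scale chart `Φ_s`** for real algebraic
`s` with `1/s ≥ 1` or `1/s < 0`: `f` is integrable on `Φ_s '' □`, since `s² x₀ · f(Φ_s x)` is the
dilogarithm integrand `1/(1/s − x₀x₁)` on `□` (`bss_pullback`), integrable by
`integrableOn_dilogIntegrand`. [cite: KontsevichZagier2001, §1.1] -/
theorem spA_integrableOn_f_image {s : ℝ} (hs : 1 ≤ 1 / s ∨ 1 / s < 0)
    {Φ : (Fin 2 → ℝ) → (Fin 2 → ℝ)} {Φ' : (Fin 2 → ℝ) → (Fin 2 → ℝ) →L[ℝ] (Fin 2 → ℝ)}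
    (hΦ0 : ∀ x, Φ x 0 = s * x 0) (hΦ1 : ∀ x, Φ x 1 = s * x 0 * x 1)
    (hderiv : ∀ x, HasFDerivAt Φ (Φ' x) x)
    (hinj : Set.InjOn Φ {x : Fin 2 → ℝ | ∀ i, x i ∈ Set.Ioo (0:ℝ) 1})
    (hdet : ∀ x ∈ {x : Fin 2 → ℝ | ∀ i, x i ∈ Set.Ioo (0:ℝ) 1}, |(Φ' x).det| = s ^ 2 * x 0) :
    IntegrableOn (fun t : Fin 2 → ℝ => 1 / (t 0 * (1 - t 1)))
      (Φ '' {x : Fin 2 → ℝ | ∀ i, x i ∈ Set.Ioo (0:ℝ) 1}) := by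
  have hs0 : s ≠ 0 := by
    rintro rfl
    norm_num at hs
  refine spA_integrableOn_image_chart hderiv hinj hdet ?_
  refine (integrableOn_dilogIntegrand hs).congr_fun (fun x hx => ?_)
    (isSemialgebraic_box 2).measurableSet_holds
  show 1 / (1 / s - x 0 * x 1) = s ^ 2 * x 0 * (1 / (Φ x 0 * (1 - Φ x 1)))
  rw [hΦ0, hΦ1]
  exact (bss_pullback (one_div_mul_cancel hs0) (hx 0).1.ne' (dilogDen_ne_zero hs hx)).trans
    (mul_comm _ _)

/-- **Absolute convergence of `A(z)`.** For real algebraic `0 < z ≤ 1`, `1/(t₀(1 − t₁))` is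
integrable on `{0 < t₁ < t₀ < z} = Φ_z '' □` (pull-back: the dilogarithm integrand with
`a = 1/z ≥ 1`). [cite: KontsevichZagier2001, §1.1] -/
theorem spA_integrableOn_A {z : ℝ} (hza : IsAlgebraic ℚ z) (hz : 0 < z) (hz1 : z ≤ 1) :
    IntegrableOn (fun t : Fin 2 → ℝ => 1 / (t 0 * (1 - t 1)))
      {t | 0 < t 1 ∧ t 1 < t 0 ∧ t 0 < z} := by
  obtain ⟨Φ, Φ', hΦ0, hΦ1, -, hderiv, hinj, hdet⟩ := bss_exists_mergeScaleChart hza hz.ne'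
  rw [← bss_image_box_of_pos hz hΦ0 hΦ1]
  exact spA_integrableOn_f_image (Or.inl (one_le_one_div hz hz1)) hΦ0 hΦ1 hderiv hinj hdet

/-- **Absolute convergence of `A'(w)`.** For real algebraic `w < 0`, `1/(t₀(1 − t₁))` is
integrable on `{w < t₀ < t₁ < 0} = Φ_w '' □` (pull-back: the dilogarithm integrand with
`a = 1/w < 0`). [cite: KontsevichZagier2001, §1.1] -/
theorem spA_integrableOn_A' {w : ℝ} (hwa : IsAlgebraic ℚ w) (hw : w < 0) :
    IntegrableOn (fun t : Fin 2 → ℝ => 1 / (t 0 * (1 - t 1)))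
      {t | w < t 0 ∧ t 0 < t 1 ∧ t 1 < 0} := by
  obtain ⟨Φ, Φ', hΦ0, hΦ1, -, hderiv, hinj, hdet⟩ := bss_exists_mergeScaleChart hwa hw.ne
  rw [← bss_image_box_of_neg hw hΦ0 hΦ1]
  exact spA_integrableOn_f_image (Or.inr (one_div_neg.2 hw)) hΦ0 hΦ1 hderiv hinj hdet

/-- The pulled-back Möbius denominators: for `0 < z < 1` and `x` in the open unit box,
`(1 − z)(1 − x₀x₁) ≤ (1 − z x₀)(1 − z x₀ x₁)` and `0 < (1 − z)(1 − x₀x₁)`. [folklore] -/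
theorem spA_moebiusDen_bounds {z : ℝ} (hz : 0 < z) (hz1 : z < 1) {x : Fin 2 → ℝ}
    (hx : ∀ i, x i ∈ Set.Ioo (0:ℝ) 1) :
    (1 - z) * (1 - x 0 * x 1) ≤ (1 - z * x 0) * (1 - z * x 0 * x 1) ∧
      0 < (1 - z) * (1 - x 0 * x 1) := by
  have hp := mul_mem_Ioo_of_mem_box hx
  have h1 : 1 - z ≤ 1 - z * x 0 := by linarith [mul_le_of_le_one_right hz.le (hx 0).2.le]
  have h2 : 1 - x 0 * x 1 ≤ 1 - z * x 0 * x 1 := by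
    rw [mul_assoc]
    linarith [mul_le_of_le_one_left hp.1.le hz1.le]
  have h1' : 0 < 1 - z := sub_pos.2 hz1
  have h2' : 0 < 1 - x 0 * x 1 := sub_pos.2 hp.2
  exact ⟨mul_le_mul h1 h2 h2'.le (h1'.le.trans h1), mul_pos h1' h2'⟩

/-- **Absolute convergence of the Möbius piece `M(z)`.** For real algebraic `0 < z < 1`,
`−1/(t₀(1 − t₀)(1 − t₁))` is integrable on `{0 < t₁ < t₀ < z} = Φ_z '' □`: the pull-back
`z² x₀ · m(Φ_z x) = −z/((1 − z x₀)(1 − z x₀x₁))` is continuous on the open unit box and dominated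
there by `(z/(1 − z))/(1 − x₀x₁)` (`integrableOn_box_of_abs_le`).
[cite: KontsevichZagier2001, §1.1] -/
theorem spA_integrableOn_M {z : ℝ} (hza : IsAlgebraic ℚ z) (hz : 0 < z) (hz1 : z < 1) :
    IntegrableOn (fun t : Fin 2 → ℝ => -1 / (t 0 * (1 - t 0) * (1 - t 1)))
      {t | 0 < t 1 ∧ t 1 < t 0 ∧ t 0 < z} := by
  obtain ⟨Φ, Φ', hΦ0, hΦ1, -, hderiv, hinj, hdet⟩ := bss_exists_mergeScaleChart hza hz.ne'
  rw [← bss_image_box_of_pos hz hΦ0 hΦ1]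
  refine spA_integrableOn_image_chart hderiv hinj hdet ?_
  have hG : IntegrableOn (fun x : Fin 2 → ℝ => -z / ((1 - z * x 0) * (1 - z * x 0 * x 1)))
      {x | ∀ i, x i ∈ Set.Ioo (0:ℝ) 1} := by
    refine integrableOn_box_of_abs_le (z / (1 - z)) ?_ fun x hx => ?_
    · exact ContinuousOn.div continuousOn_const (by fun_prop) fun x hx =>
        ((spA_moebiusDen_bounds hz hz1 hx).2.trans_le (spA_moebiusDen_bounds hz hz1 hx).1).ne'
    · obtain ⟨hle, hpos⟩ := spA_moebiusDen_bounds hz hz1 hx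
      show |-z / ((1 - z * x 0) * (1 - z * x 0 * x 1))| ≤ z / (1 - z) / (1 - x 0 * x 1)
      rw [abs_div, abs_neg, abs_of_pos hz, abs_of_pos (hpos.trans_le hle), div_div]
      exact div_le_div_of_nonneg_left hz.le hpos hle
  refine hG.congr_fun (fun x hx => ?_) (isSemialgebraic_box 2).measurableSet_holds
  obtain ⟨hle, hpos⟩ := spA_moebiusDen_bounds hz hz1 hx
  have hD : (1 - z * x 0) * (1 - z * x 0 * x 1) ≠ 0 := (hpos.trans_le hle).ne'
  have hE : z * x 0 * (1 - z * x 0) * (1 - z * x 0 * x 1) ≠ 0 := by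
    rw [mul_assoc]
    exact mul_ne_zero (mul_ne_zero hz.ne' (hx 0).1.ne') hD
  show -z / ((1 - z * x 0) * (1 - z * x 0 * x 1)) =
    z ^ 2 * x 0 * (-1 / (Φ x 0 * (1 - Φ x 0) * (1 - Φ x 1)))
  rw [hΦ0, hΦ1, mul_div_assoc', div_eq_div_iff hD hE]
  ring

/-! ## Semialgebraicity of the domains and integrands -/

-- adapted from `KZ.isSemialgebraic_setOf_apply_lt_const`, `KZ.isSemialgebraic_setOf_const_lt_apply`
-- in Literature/NumberTheory/Transcendental/EllIterRep.lean
/-- `{t | t i < c}` and `{t | c < t i}` are `ℚ`-semialgebraic for a real algebraic `c` (the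
negativity sets of the `ℚ`-semialgebraic functions `t i − c` and `c − t i`). [folklore] -/
theorem spA_isSemialgebraic_halfSpaces {c : ℝ} (hc : IsAlgebraic ℚ c) (i : Fin 2) :
    IsSemialgebraic ℚ {t : Fin 2 → ℝ | t i < c} ∧ IsSemialgebraic ℚ {t : Fin 2 → ℝ | c < t i} := by
  have hU : IsSemialgebraic ℚ (univ : Set (Fin 2 → ℝ)) :=
    Literature.ModelTheory.ExponentialFields.isSemialgebraic_univ
  have hi := isSemialgebraicFunOn_apply hU i
  have hc' := isSemialgebraicFunOn_const_of_isAlgebraic hU hc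
  have h1 : IsSemialgebraicFunOn ℚ univ (fun t => t i - c) :=
    (IsSemialgebraicFunOn.sub_holds hi hc').congr fun _ _ => rfl
  have h2 : IsSemialgebraicFunOn ℚ univ (fun t => c - t i) :=
    (IsSemialgebraicFunOn.sub_holds hc' hi).congr fun _ _ => rfl
  constructor
  · convert h1.isSemialgebraic_sep_neg using 1
    ext t
    simp [sub_neg]
  · convert h2.isSemialgebraic_sep_neg using 1
    ext t
    simp [sub_neg]

/-- **The simplex bands are `ℚ`-semialgebraic:** for real algebraic `c, d` and coordinates `i, j`,
`{c < tᵢ < tⱼ < d} = {c < tᵢ} ∩ {tᵢ < tⱼ} ∩ {tⱼ < d}`, the middle one a strict `ℚ`-polynomial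
inequality (`i = 1, j = 0, c = 0, d = z`: the piece `A(z)`; `i = 0, j = 1, c = w, d = 0`: the
piece `A'(w)`). [cite: KontsevichZagier2001, §1.1] -/
theorem spA_isSemialgebraic_band {c d : ℝ} (hc : IsAlgebraic ℚ c) (hd : IsAlgebraic ℚ d)
    (i j : Fin 2) : IsSemialgebraic ℚ {t : Fin 2 → ℝ | c < t i ∧ t i < t j ∧ t j < d} := by
  have h2 := Literature.ModelTheory.ExponentialFields.isSemialgebraic_setOf_eval_lt (k := ℚ)
    (R := ℝ) (MvPolynomial.X i : MvPolynomial (Fin 2) ℚ) (MvPolynomial.X j)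
  simp only [MvPolynomial.aeval_X] at h2
  convert ((spA_isSemialgebraic_halfSpaces hc i).2.inter h2).inter
    (spA_isSemialgebraic_halfSpaces hd j).1 using 1
  ext t
  simp only [mem_setOf_eq, mem_inter_iff, and_assoc]

/-- **Semialgebraicity of `f = 1/(t₀(1 − t₁))`** on any `ℚ`-semialgebraic set on which
`t₀ ≠ 0` and `t₁ ≠ 1`: a quotient of `ℚ`-polynomials with non-vanishing denominator
(`isSemialgebraicFunOn_aeval_div_aeval`). [cite: KontsevichZagier2001, §1.1] -/
theorem spA_isSemialgebraicFunOn_f {σ : Set (Fin 2 → ℝ)} (hσ : IsSemialgebraic ℚ σ)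
    (h0 : ∀ t ∈ σ, t 0 ≠ 0) (h1 : ∀ t ∈ σ, 1 - t 1 ≠ 0) :
    IsSemialgebraicFunOn ℚ σ (fun t => 1 / (t 0 * (1 - t 1))) := by
  refine (isSemialgebraicFunOn_aeval_div_aeval hσ (1 : MvPolynomial (Fin 2) ℚ)
    (MvPolynomial.X 0 * (1 - MvPolynomial.X 1)) fun t ht => ?_).congr fun t _ => ?_
  · simp only [map_mul, map_sub, map_one, MvPolynomial.aeval_X]
    exact mul_ne_zero (h0 t ht) (h1 t ht)
  · simp only [map_mul, map_sub, map_one, MvPolynomial.aeval_X]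

/-- **Semialgebraicity of the Möbius integrand `−1/(t₀(1 − t₀)(1 − t₁))`** on any
`ℚ`-semialgebraic set on which `t₀ ≠ 0, 1` and `t₁ ≠ 1`. [cite: KontsevichZagier2001, §1.1] -/
theorem spA_isSemialgebraicFunOn_m {σ : Set (Fin 2 → ℝ)} (hσ : IsSemialgebraic ℚ σ)
    (h0 : ∀ t ∈ σ, t 0 ≠ 0) (h0' : ∀ t ∈ σ, 1 - t 0 ≠ 0) (h1 : ∀ t ∈ σ, 1 - t 1 ≠ 0) :
    IsSemialgebraicFunOn ℚ σ (fun t => -1 / (t 0 * (1 - t 0) * (1 - t 1))) := by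
  refine (isSemialgebraicFunOn_aeval_div_aeval hσ (-1 : MvPolynomial (Fin 2) ℚ)
    (MvPolynomial.X 0 * (1 - MvPolynomial.X 0) * (1 - MvPolynomial.X 1)) fun t ht => ?_).congr
    fun t _ => ?_
  · simp only [map_mul, map_sub, map_one, MvPolynomial.aeval_X]
    exact mul_ne_zero (mul_ne_zero (h0 t ht) (h0' t ht)) (h1 t ht)
  · simp only [map_mul, map_sub, map_neg, map_one, MvPolynomial.aeval_X]

/-! ## The registered sub-goal -/

/-- **Stub S1b-one (existence of the simplex pieces `A`, `A'`, `M` of the dilogarithm layer;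
registered sub-goal `exists_simplexPieces_one` of stmt-KontsevichZagierPeriods-3869, line
`SketchIdeator1`).** With `f(t) = 1/(t₀(1 − t₁))`: (i) for every real algebraic `0 < z ≤ 1` the
piece `A(z) = [{0 < t₁ < t₀ < z}, f]` exists; (ii) for every real algebraic `w < 0` the piece
`A'(w) = [{w < t₀ < t₁ < 0}, f]` exists; (iii) for every real algebraic `0 < z < 1` the Möbius
piece `M(z) = [{0 < t₁ < t₀ < z}, −1/(t₀(1 − t₀)(1 − t₁))]` exists — each as an integral
representation of the Kontsevich–Zagier calculus with literally these domains and integrands.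
[cite: KontsevichZagier2001, §1.1] -/
theorem exists_simplexPieces_one :
    (∀ z : ℝ, IsAlgebraic ℚ z → 0 < z → z ≤ 1 →
      ∃ A : IntegralRep 2, A.domain = {t | 0 < t 1 ∧ t 1 < t 0 ∧ t 0 < z} ∧
        A.integrand = fun t => 1 / (t 0 * (1 - t 1))) ∧
    (∀ w : ℝ, IsAlgebraic ℚ w → w < 0 →
      ∃ A' : IntegralRep 2, A'.domain = {t | w < t 0 ∧ t 0 < t 1 ∧ t 1 < 0} ∧
        A'.integrand = fun t => 1 / (t 0 * (1 - t 1))) ∧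
    (∀ z : ℝ, IsAlgebraic ℚ z → 0 < z → z < 1 →
      ∃ M : IntegralRep 2, M.domain = {t | 0 < t 1 ∧ t 1 < t 0 ∧ t 0 < z} ∧
        M.integrand = fun t => -1 / (t 0 * (1 - t 0) * (1 - t 1))) := by
  refine ⟨fun z hz hz0 hz1 => ?_, fun w hw hw0 => ?_, fun z hz hz0 hz1 => ?_⟩
  · have hσ : IsSemialgebraic ℚ {t : Fin 2 → ℝ | 0 < t 1 ∧ t 1 < t 0 ∧ t 0 < z} :=
      spA_isSemialgebraic_band isAlgebraic_zero hz 1 0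
    exact ⟨⟨_, _, hσ, spA_isSemialgebraicFunOn_f hσ (fun _ ht => (ht.1.trans ht.2.1).ne')
      (fun _ ht => (sub_pos.2 ((ht.2.1.trans ht.2.2).trans_le hz1)).ne'),
      spA_integrableOn_A hz hz0 hz1⟩, rfl, rfl⟩
  · have hσ : IsSemialgebraic ℚ {t : Fin 2 → ℝ | w < t 0 ∧ t 0 < t 1 ∧ t 1 < 0} :=
      spA_isSemialgebraic_band hw isAlgebraic_zero 0 1
    exact ⟨⟨_, _, hσ, spA_isSemialgebraicFunOn_f hσ (fun _ ht => (ht.2.1.trans ht.2.2).ne)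
      (fun _ ht => (sub_pos.2 (ht.2.2.trans one_pos)).ne'), spA_integrableOn_A' hw hw0⟩, rfl, rfl⟩
  · have hσ : IsSemialgebraic ℚ {t : Fin 2 → ℝ | 0 < t 1 ∧ t 1 < t 0 ∧ t 0 < z} :=
      spA_isSemialgebraic_band isAlgebraic_zero hz 1 0
    exact ⟨⟨_, _, hσ, spA_isSemialgebraicFunOn_m hσ (fun _ ht => (ht.1.trans ht.2.1).ne')
      (fun _ ht => (sub_pos.2 (ht.2.2.trans hz1)).ne')
      (fun _ ht => (sub_pos.2 ((ht.2.1.trans ht.2.2).trans hz1)).ne'),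
      spA_integrableOn_M hz hz0 hz1⟩, rfl, rfl⟩

end Summit.KontsevichZagierPeriods.HurwitzMicroSectors.NormalFormPrinciple.PiBox.Dilog
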